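import Mathlib
import Summits.Ventures.PercRepro2.Defs
import Summits.Ventures.PercRepro2.Harris
import Summits.Ventures.PercRepro2.CoinDefs
import Summits.Ventures.PercRepro2.CoinInduced
import Summits.Ventures.PercRepro2.CoinLsmCoreDefs
import Summits.Ventures.PercRepro2.CoinLsmCoreU
import Summits.Ventures.PercRepro2.CoinOrTailKDefs
import Summits.Ventures.PercRepro2.CoinOrTailKSums
import Summits.Ventures.PercRepro2.CoinKSureCoinsAlg
import Summits.Ventures.PercRepro2.CoinSubdivide

/-!
# The subdivided OR-tail: sure entries on an extended log-supermodular core (blind cell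
PercRepro2, night-2 g15; proofs/NIGHT2-DARC.md §52)

Subdividing the entry coins `c r : r → a` of an OR-tail `OrTailK arcs s U ent c a` (§52,
`CoinSubdivide`) produces an OR-tail of the subdivided system whose entries are the new vertices
`inr (c r)`, entered from `inl r` by the old coin and entering `inl a` by the new SURE coin
(`orTailK_sub`).  Its core is `subCore U S = U.map inl ∪ S.map inr`, and its cluster law is the
old one times one coin factor per subdivided coin — log-supermodular by `extLaw_lsm`, one
virtual vertex at a time (`subCore_lsm`; each step is a one-entry OR-tail `orTailK_sub_step`).
With §51 this gives the marker-at-the-tail theorems for ARBITRARY coins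
(`CoinKSureTailCoins`).
-/

namespace Summit.Ventures.PercRepro2.Coin

open Classical

section SubCore

variable {V : Type*} {E : Type*} [DecidableEq V] [DecidableEq E]

/-- The extended core: the old core and the new vertices of the subdivided coins `S₀`. -/
def subCore (U : Finset V) (S₀ : Finset E) : Finset (V ⊕ E) :=
  U.map Function.Embedding.inl ∪ S₀.map Function.Embedding.inr

/-- Membership of an old vertex in the extended core. -/
lemma inl_mem_subCore {U : Finset V} {S₀ : Finset E} {v : V} :
    Sum.inl v ∈ subCore U S₀ ↔ v ∈ U := by
  unfold subCore
  rw [Finset.mem_union]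
  constructor
  · rintro (h | h)
    · obtain ⟨u, hu, huv⟩ := Finset.mem_map.1 h
      have huv' : Sum.inl u = Sum.inl v := huv
      rw [← Sum.inl_injective huv']
      exact hu
    · obtain ⟨e, _, he⟩ := Finset.mem_map.1 h
      exact absurd he Sum.inr_ne_inl
  · intro hv
    exact Or.inl (Finset.mem_map.2 ⟨v, hv, rfl⟩)

/-- Membership of a new vertex in the extended core. -/
lemma inr_mem_subCore {U : Finset V} {S₀ : Finset E} {e : E} :
    Sum.inr e ∈ subCore U S₀ ↔ e ∈ S₀ := by
  unfold subCore
  rw [Finset.mem_union]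
  constructor
  · rintro (h | h)
    · obtain ⟨v, _, hv⟩ := Finset.mem_map.1 h
      exact absurd hv Sum.inl_ne_inr
    · obtain ⟨e', he', hee⟩ := Finset.mem_map.1 h
      have hee' : Sum.inr e' = Sum.inr e := hee
      rw [← Sum.inr_injective hee']
      exact he'
  · intro he
    exact Or.inr (Finset.mem_map.2 ⟨e, he, rfl⟩)

/-- Extending the core by one new vertex. -/
lemma subCore_insert (U : Finset V) (S₀ : Finset E) (e : E) :
    subCore U (insert e S₀) = insert (Sum.inr e) (subCore U S₀) := by
  unfold subCore
  rw [Finset.map_insert, Finset.union_insert]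
  rfl

/-- The source of a subdivided entry coin: the entry `r` with `c r = e`. -/
noncomputable def srcOf (ent : Finset V) (c : V → E) (s : V) (e : E) : V :=
  if h : ∃ r ∈ ent, c r = e then h.choose else s

omit [DecidableEq V] in
/-- `srcOf` inverts `c` on the entries. -/
lemma srcOf_apply {ent : Finset V} {c : V → E} (s : V)
    (hcinj : ∀ r ∈ ent, ∀ r' ∈ ent, c r = c r' → r = r') {r : V} (hr : r ∈ ent) :
    srcOf ent c s (c r) = r := by
  unfold srcOf
  have h : ∃ r' ∈ ent, c r' = c r := ⟨r, hr, rfl⟩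
  rw [dif_pos h]
  obtain ⟨hmem, hc⟩ := h.choose_spec
  exact hcinj _ hmem r hr hc

end SubCore

section SubOrTail

variable {V : Type*} {E : Type*} [DecidableEq V] [DecidableEq E]
  {arcs : E → Finset (V × V)} {s : V} {U : Finset V} {ent : Finset V} {c : V → E} {a : V}

omit [DecidableEq V] in
/-- The entry coins are single arcs into `a` with the source `srcOf`. -/
lemma OrTailK.arcs_entry (h : OrTailK arcs s U ent c a) :
    ∀ e ∈ ent.image c, arcs e = {(srcOf ent c s e, (fun _ => a) e)} := by
  intro e he
  obtain ⟨r, hr, rfl⟩ := Finset.mem_image.1 he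
  rw [srcOf_apply s h.c_inj hr]
  exact h.arcs_c r hr

omit [DecidableEq V] in
/-- The source of an entry coin is an entry. -/
lemma OrTailK.srcOf_mem (h : OrTailK arcs s U ent c a) {e : E} (he : e ∈ ent.image c) :
    srcOf ent c s e ∈ ent := by
  obtain ⟨r, hr, rfl⟩ := Finset.mem_image.1 he
  rw [srcOf_apply s h.c_inj hr]
  exact hr

/-- **One step of the extension**: in the subdivided system, the new vertex `inr e` of an entry
coin `e ∉ S₀` is a ONE-ENTRY OR-tail of the extended core `subCore U S₀`, entered from
`inl (srcOf e)` by the coin `inl e`. -/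
theorem orTailK_sub_step (h : OrTailK arcs s U ent c a) {S₀ : Finset E}
    {e : E} (he : e ∈ ent.image c) (heS₀ : e ∉ S₀) :
    OrTailK (subArcs arcs (ent.image c) (srcOf ent c s) (fun _ => a)) (Sum.inl s)
      (subCore U S₀) {Sum.inl (srcOf ent c s e)} (fun _ => Sum.inl e) (Sum.inr e) where
  ent_sub := by
    intro x hx
    rw [Finset.mem_singleton] at hx
    rw [hx, inl_mem_subCore]
    exact h.ent_sub (h.srcOf_mem he)
  s_notin := by rw [inl_mem_subCore]; exact h.s_notin
  a_notin := by rw [inr_mem_subCore]; exact heS₀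
  a_ne_s := Sum.inr_ne_inl
  into_U := by
    intro e' xy hxy hy
    cases e' with
    | inl e₁ =>
      simp only [subArcs] at hxy
      by_cases h₁ : e₁ ∈ ent.image c
      · rw [if_pos h₁, Finset.mem_singleton] at hxy
        rw [hxy]
        exact Or.inl ((inl_mem_subCore).2 (h.ent_sub (h.srcOf_mem h₁)))
      · rw [if_neg h₁] at hxy
        obtain ⟨⟨x, y⟩, hxy₀, hf⟩ := Finset.mem_map.1 hxy
        have hf' : (Sum.inl x, Sum.inl y) = xy := hf
        rw [← hf'] at hy ⊢
        have hyU : y ∈ U := (inl_mem_subCore).1 hy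
        rcases h.into_U e₁ (x, y) hxy₀ hyU with hx | hx
        · exact Or.inl ((inl_mem_subCore).2 hx)
        · exact Or.inr (by rw [show x = s from hx])
    | inr e₁ =>
      simp only [subArcs] at hxy
      by_cases h₁ : e₁ ∈ ent.image c
      · rw [if_pos h₁, Finset.mem_singleton] at hxy
        rw [hxy] at hy
        exact absurd ((inl_mem_subCore).1 hy) h.a_notin
      · rw [if_neg h₁] at hxy
        exact absurd hxy (Finset.notMem_empty _)
  into_s := by
    intro e' xy hxy hy
    cases e' with
    | inl e₁ =>
      simp only [subArcs] at hxy
      by_cases h₁ : e₁ ∈ ent.image c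
      · rw [if_pos h₁, Finset.mem_singleton] at hxy
        rw [hxy] at hy
        exact absurd hy Sum.inr_ne_inl
      · rw [if_neg h₁] at hxy
        obtain ⟨⟨x, y⟩, hxy₀, hf⟩ := Finset.mem_map.1 hxy
        have hf' : (Sum.inl x, Sum.inl y) = xy := hf
        rw [← hf'] at hy ⊢
        have hys : y = s := Sum.inl_injective hy
        rcases h.into_s e₁ (x, y) hxy₀ hys with hx | hx
        · exact Or.inl ((inl_mem_subCore).2 hx)
        · exact Or.inr (by rw [show x = s from hx])
    | inr e₁ =>
      simp only [subArcs] at hxy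
      by_cases h₁ : e₁ ∈ ent.image c
      · rw [if_pos h₁, Finset.mem_singleton] at hxy
        rw [hxy] at hy
        exact absurd (Sum.inl_injective hy) h.a_ne_s
      · rw [if_neg h₁] at hxy
        exact absurd hxy (Finset.notMem_empty _)
  into_a := by
    intro e' xy hxy hy
    cases e' with
    | inl e₁ =>
      simp only [subArcs] at hxy
      by_cases h₁ : e₁ ∈ ent.image c
      · rw [if_pos h₁, Finset.mem_singleton] at hxy
        rw [hxy] at hy ⊢
        have : e₁ = e := Sum.inr_injective hy
        subst this
        exact ⟨Sum.inl (srcOf ent c s e₁), Finset.mem_singleton_self _, rfl, rfl⟩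
      · rw [if_neg h₁] at hxy
        obtain ⟨⟨x, y⟩, _, hf⟩ := Finset.mem_map.1 hxy
        have hf' : (Sum.inl x, Sum.inl y) = xy := hf
        rw [← hf'] at hy
        exact absurd hy Sum.inl_ne_inr
    | inr e₁ =>
      simp only [subArcs] at hxy
      by_cases h₁ : e₁ ∈ ent.image c
      · rw [if_pos h₁, Finset.mem_singleton] at hxy
        rw [hxy] at hy
        exact absurd hy Sum.inl_ne_inr
      · rw [if_neg h₁] at hxy
        exact absurd hxy (Finset.notMem_empty _)
  arcs_c := by
    intro r hr
    rw [Finset.mem_singleton] at hr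
    rw [hr]
    simp only [subArcs, if_pos he]
  c_inj := by
    intro r hr r' hr' _
    rw [Finset.mem_singleton] at hr hr'
    rw [hr, hr']

/-- **The subdivided OR-tail**: the tail `inl a` is entered only from the new vertices
`inr e`, `e` an entry coin, by the new sure coins. -/
theorem orTailK_sub (h : OrTailK arcs s U ent c a) :
    OrTailK (subArcs arcs (ent.image c) (srcOf ent c s) (fun _ => a)) (Sum.inl s)
      (subCore U (ent.image c)) ((ent.image c).map Function.Embedding.inr)
      (Sum.elim (fun v => Sum.inl (c v)) (fun e => Sum.inr e)) (Sum.inl a) where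
  ent_sub := by
    intro x hx
    obtain ⟨e, he, rfl⟩ := Finset.mem_map.1 hx
    exact (inr_mem_subCore).2 he
  s_notin := by rw [inl_mem_subCore]; exact h.s_notin
  a_notin := by rw [inl_mem_subCore]; exact h.a_notin
  a_ne_s := fun e => h.a_ne_s (Sum.inl_injective e)
  into_U := by
    intro e' xy hxy hy
    cases e' with
    | inl e₁ =>
      simp only [subArcs] at hxy
      by_cases h₁ : e₁ ∈ ent.image c
      · rw [if_pos h₁, Finset.mem_singleton] at hxy
        rw [hxy]
        exact Or.inl ((inl_mem_subCore).2 (h.ent_sub (h.srcOf_mem h₁)))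
      · rw [if_neg h₁] at hxy
        obtain ⟨⟨x, y⟩, hxy₀, hf⟩ := Finset.mem_map.1 hxy
        have hf' : (Sum.inl x, Sum.inl y) = xy := hf
        rw [← hf'] at hy ⊢
        have hyU : y ∈ U := (inl_mem_subCore).1 hy
        rcases h.into_U e₁ (x, y) hxy₀ hyU with hx | hx
        · exact Or.inl ((inl_mem_subCore).2 hx)
        · exact Or.inr (by rw [show x = s from hx])
    | inr e₁ =>
      simp only [subArcs] at hxy
      by_cases h₁ : e₁ ∈ ent.image c
      · rw [if_pos h₁, Finset.mem_singleton] at hxy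
        rw [hxy] at hy
        exact absurd ((inl_mem_subCore).1 hy) h.a_notin
      · rw [if_neg h₁] at hxy
        exact absurd hxy (Finset.notMem_empty _)
  into_s := by
    intro e' xy hxy hy
    cases e' with
    | inl e₁ =>
      simp only [subArcs] at hxy
      by_cases h₁ : e₁ ∈ ent.image c
      · rw [if_pos h₁, Finset.mem_singleton] at hxy
        rw [hxy] at hy
        exact absurd hy Sum.inr_ne_inl
      · rw [if_neg h₁] at hxy
        obtain ⟨⟨x, y⟩, hxy₀, hf⟩ := Finset.mem_map.1 hxy
        have hf' : (Sum.inl x, Sum.inl y) = xy := hf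
        rw [← hf'] at hy ⊢
        have hys : y = s := Sum.inl_injective hy
        rcases h.into_s e₁ (x, y) hxy₀ hys with hx | hx
        · exact Or.inl ((inl_mem_subCore).2 hx)
        · exact Or.inr (by rw [show x = s from hx])
    | inr e₁ =>
      simp only [subArcs] at hxy
      by_cases h₁ : e₁ ∈ ent.image c
      · rw [if_pos h₁, Finset.mem_singleton] at hxy
        rw [hxy] at hy
        exact absurd (Sum.inl_injective hy) h.a_ne_s
      · rw [if_neg h₁] at hxy
        exact absurd hxy (Finset.notMem_empty _)
  into_a := by
    intro e' xy hxy hy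
    cases e' with
    | inl e₁ =>
      simp only [subArcs] at hxy
      by_cases h₁ : e₁ ∈ ent.image c
      · rw [if_pos h₁, Finset.mem_singleton] at hxy
        rw [hxy] at hy
        exact absurd hy Sum.inr_ne_inl
      · rw [if_neg h₁] at hxy
        obtain ⟨⟨x, y⟩, hxy₀, hf⟩ := Finset.mem_map.1 hxy
        have hf' : (Sum.inl x, Sum.inl y) = xy := hf
        rw [← hf'] at hy
        have hya : y = a := Sum.inl_injective hy
        obtain ⟨r, hr, he₁, _⟩ := h.into_a e₁ (x, y) hxy₀ hya
        exact absurd (he₁ ▸ Finset.mem_image_of_mem c hr) h₁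
    | inr e₁ =>
      simp only [subArcs] at hxy
      by_cases h₁ : e₁ ∈ ent.image c
      · rw [if_pos h₁, Finset.mem_singleton] at hxy
        rw [hxy]
        exact ⟨Sum.inr e₁, Finset.mem_map_of_mem _ h₁, rfl, rfl⟩
      · rw [if_neg h₁] at hxy
        exact absurd hxy (Finset.notMem_empty _)
  arcs_c := by
    intro r hr
    obtain ⟨e, he, rfl⟩ := Finset.mem_map.1 hr
    change subArcs arcs (ent.image c) (srcOf ent c s) (fun _ => a) (Sum.inr e) =
      {(Sum.inr e, Sum.inl a)}
    simp only [subArcs, if_pos he]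
  c_inj := by
    intro r hr r' hr' heq
    obtain ⟨e, _, rfl⟩ := Finset.mem_map.1 hr
    obtain ⟨e', _, rfl⟩ := Finset.mem_map.1 hr'
    change (Sum.inr e : E ⊕ E) = Sum.inr e' at heq
    change (Sum.inr e : V ⊕ E) = Sum.inr e'
    rw [Sum.inr_injective heq]

end SubOrTail

end Summit.Ventures.PercRepro2.Coin
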